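import Summits.QuantumFields.GaugeBoot.TorusKSCochains
import Summits.QuantumFields.GaugeBoot.ZdCentralTwistTorusLoops
import HarnessLib

/-!
# Kogut–Susskind staggerings of the torus: which loops see the gauge class — contractible loops none,
# loops with winding `v` the sign `z^{∑ v_m ε_m}`, Polyakov lines everything (gauge-boot, L3 structural
# supplement; `ℤ^d` twist 14)

HONEST FRAMING (cell `pub-gaugeboot`, page 1 of every file): the venture produces certified bounds
on lattice expectations at stated coupling, gauge group, dimension and torus size; NOT a mass gap,
NOT a continuum limit, NOT a string tension; NOT Yang–Mills-summit-bearing (barriers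
`FixedCouplingUltralocality`, `PerturbativeInvisibility`). This module bounds no expectation; no
certificate of the cell sits at `β < 0`. Structural bookkeeping.

`TorusKSCochains.lean` (twist 13) classified the `{1, z}`-valued Kogut–Susskind staggerings of the torus
`(ℤ/L)^d` up to gauge transformations by the `d` cycle holonomies of their differences (`2^d` classes).
Here the action on loops. A closed loop of the torus is a `ℤ^d` walk `w : x ⟶ x + L v` read through the
periodic lift (`ZdCentralTwistTorusLoops.lean`); the weights of a torus cochain `c` pull back to the
`ℤ^d` cochain `pullCochain L c (x, i) = c(x mod L; i)`:

* `IsTorusKSCochain.pull` — the pullback of a torus KS cochain is a `ℤ^d` KS cochain (twist 11's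
  `IsKSCochain`); `torusLift_centralTwist_cochainTwist` — the lift intertwines the twists;
* ★★ `IsTorusKSCochain.walkHolonomy_torusLift_centralTwist_closed` — **CONTRACTIBLE torus loops (closed
  `ℤ^d` walks) collect `z^{a(C)}` under EVERY KS staggering of the torus** — the lattice area parity of
  twist 8, the same for all `2^d` classes; ★★ `IsTorusKSCochain.wilsonExpectation_wilsonLoopObs_neg` —
  hence `⟨W_C ∘ lift⟩_{L,-β} = (-1)^{a(C)} ⟨W_C ∘ lift⟩_{L,β}` on ANY torus carrying a KS cochain;
* `TorusPoincare.apply_add_zsmul` — the full period formula `Φ(x + L v) = Φ(x) + ∑_m v_m · hol_m` for a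
  primitive of the pullback of a closed torus cochain; ★★ `walkSign_pull_of_isClosed` — **a CLOSED
  `{1,z}`-cochain `b` of the torus collects `z^{∑_m v_m hol_m(b)}` along every walk `x ⟶ x + L v`**;
* ★★★ `IsTorusKSCochain.walkSign_pull_eq` — **two KS staggerings `c₁, c₂` give the loop with winding
  `v` weights differing by `z^{∑_m v_m hol_m(c₁ + c₂)}`**: loops in the same class (`hol = 0`) or
  contractible loops (`v = 0`) cannot tell them apart (`walkSign_pull_eq_of_cycleHolonomy_eq_zero`),
  while ★★★ `IsTorusKSCochain.walkSign_pull_lineWalk` — **the Polyakov line in direction `m` detects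
  exactly the `m`-th relative holonomy**: `sign₁(P_m) = z^{hol_m(c₁ + c₂)} · sign₂(P_m)`; with twist 12
  (the parity staggering leaves every Polyakov line invariant) the sector-`ε` staggering multiplies
  `P_m` by `z^{ε_m}` (`walkSign_pull_sector_lineWalk`).

What is NOT claimed: no statement about measures beyond the contractible-loop corollary (the
closed-cochain twists are the finite-volume CENTRE SYMMETRY of the Wilson measure — not developed
here); nothing for groups without a central involution `z` with `ρ z = -1`. [folklore] bookkeeping
(Kogut–Susskind 1975; 't Hooft 1979; Polyakov 1978).
-/

noncomputable section

open MeasureTheory SimpleGraph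
open Literature.Probability.LatticeModels (Site TorusSite zdGraph Torus.proj Torus.proj_apply)
open Literature.MathematicalPhysics.QuantumFieldTheory (GaugeConfig gaugeTransform wilsonMeasure
  wilsonExpectation LatticeForm.td₀ LatticeForm.e)
open Literature.MathematicalPhysics.QuantumFieldTheory.LatticeForm (d₀ d₁ exists_d₀_eq_of_d₁_eq_zero
  eq_of_d₀_eq_zero)
open Literature.MathematicalPhysics.QuantumLattice

namespace Summit.QuantumFields.GaugeBoot

/-! ## The full period formula of a primitive of the pullback -/

namespace TorusPoincare

variable {d L : ℕ} {A : Type*} [AddCommGroup A]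

/-- ★ **The period of a primitive along `L v` is `∑_m v_m · hol_m`**: if `d₀ Φ` is the pullback of the
torus cochain `θ`, then `Φ(x + L v) = Φ(x) + ∑_m v_m • cycleHolonomy θ m` for all `x, v ∈ ℤ^d` (the
difference of the two sides has zero coboundary in `v` by `apply_add_period_single`). -/
theorem apply_add_zsmul {θ : TorusSite d L → Fin d → A} {Φ : Site d → A}
    (hΦ : d₀ Φ = fun x => θ (Torus.proj L x)) (x v : Site d) :
    Φ (x + (L : ℤ) • v) = Φ x + ∑ m, v m • cycleHolonomy θ m := by
  have hd : d₀ (fun q : Site d => Φ (x + (L : ℤ) • q) - ∑ m, q m • cycleHolonomy θ m) = 0 := by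
    funext q k
    simp only [d₀, Pi.zero_apply, smul_add, ← add_assoc, apply_add_period_single hΦ k, Pi.add_apply,
      add_smul, Finset.sum_add_distrib]
    have hk : ∑ m, (LatticeForm.e k : Site d) m • cycleHolonomy θ m = cycleHolonomy θ k := by
      rw [Finset.sum_eq_single k]
      · simp [LatticeForm.e]
      · intro m _ hm; simp [LatticeForm.e, hm]
      · intro h; exact absurd (Finset.mem_univ k) h
    rw [hk]
    abel
  have h := eq_of_d₀_eq_zero hd v 0
  simp only [smul_zero, add_zero, Pi.zero_apply, zero_smul, Finset.sum_const_zero, sub_zero] at h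
  rw [← h, sub_add_cancel]

end TorusPoincare

namespace TiltedRP

open TorusPoincare ZdPoincare

variable {d L N : ℕ} {G : Type*} [Group G]

/-! ## The pullback of a torus cochain to `ℤ^d` -/

section Pull

/-- **The pullback** of a torus cochain to the links of `ℤ^d`: `pullCochain L c (x, i) = c(x mod L; i)`. -/
def pullCochain {A : Type*} (L : ℕ) (c : TorusSite d L → Fin d → A) : ZdEdge d → A :=
  fun e => c (Torus.proj L e.1) e.2

/-- `pullCochain` evaluated. -/
@[simp] theorem pullCochain_apply {A : Type*} (L : ℕ) (c : TorusSite d L → Fin d → A) (x : Site d)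
    (i : Fin d) : pullCochain L c (x, i) = c (Torus.proj L x) i := rfl

/-- **The pullback of a torus KS cochain is a `ℤ^d` KS cochain.** -/
theorem IsTorusKSCochain.pull {c : TorusSite d L → Fin d → ZMod 2} (hc : IsTorusKSCochain c) :
    IsKSCochain (pullCochain L c) := by
  intro x k l hkl
  have h := hc (Torus.proj L x) k l hkl
  simpa only [pullCochain_apply, torusProj_add_single, Int.cast_one] using h

variable {z : G}

/-- ★ **The periodic lift intertwines the torus twist by `c` and the `ℤ^d` twist by its pullback.** -/
theorem torusLift_centralTwist_cochainTwist (z : G) (c : TorusSite d L → Fin d → ZMod 2)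
    (U : GaugeConfig d L G) :
    torusLift L (centralTwist (cochainTwist z c) U) =
      centralTwist (zpow₂ z ∘ pullCochain L c) (torusLift L U) := rfl

/-- The weights of a sum of cochains pull back to the product of the weights (central first factor). -/
theorem zpow₂_comp_pullCochain_add (hz2 : z * z = 1) (b c : TorusSite d L → Fin d → ZMod 2) :
    (zpow₂ z ∘ pullCochain L (b + c)) = fun l => (zpow₂ z ∘ pullCochain L b) l * (zpow₂ z ∘ pullCochain L c) l := by
  funext l
  simp only [Function.comp_apply, pullCochain, Pi.add_apply, zpow₂_add hz2]

end Pull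

/-! ## Contractible loops see no class -/

section Contractible

variable {z : G} {π : Fin d → Site d →+ ZMod 2}

/-- ★★ **Contractible torus loops collect `z^{a(C)}` under EVERY Kogut–Susskind staggering of the
torus**: for a torus KS cochain `c`, a closed `ℤ^d` walk `C` and any torus configuration `U`,
`hol_C(lift(T_c U)) = z^{a(C)} · hol_C(lift U)` with `a(C)` the lattice area parity — the same sign for
all `2^d` gauge classes. -/
theorem IsTorusKSCochain.walkHolonomy_torusLift_centralTwist_closed {c : TorusSite d L → Fin d → ZMod 2}
    (hc : IsTorusKSCochain c) (hπ : IsDualParity (zdUnit d) π) (hzc : ∀ g : G, z * g = g * z)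
    (hz2 : z * z = 1) (U : GaugeConfig d L G) {x : Site d} (C : (zdGraph d).Walk x x) :
    walkHolonomy (torusLift L (centralTwist (cochainTwist z c) U)) C =
      zpow₂ z (areaParity π C) * walkHolonomy (torusLift L U) C := by
  rw [torusLift_centralTwist_cochainTwist]
  exact hc.pull.walkHolonomy_centralTwist_closed hπ hzc hz2 _ C

variable {G : Type} [Group G] [TopologicalSpace G] [IsTopologicalGroup G] [CompactSpace G]
  [MeasurableSpace G] [BorelSpace G] [SecondCountableTopology G] {z : G}
variable (ρ : G →* Matrix (Fin N) (Fin N) ℂ)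

/-- ★★ **`⟨W_C ∘ lift⟩_{L,-β} = (-1)^{a(C)} ⟨W_C ∘ lift⟩_{L,β}` on ANY torus carrying a Kogut–Susskind
cochain** (continuous `ρ` with `ρ z = -1`, every closed `ℤ^d` walk `C`, every real `β`): the torus twist
by `c` maps the Wilson measure at `β` to the one at `-β` (`IsStaggering.integral_comp_centralTwist_gibbs`)
and multiplies `W_C ∘ lift` by `(-1)^{a(C)}`. (Twist 12 had this for the parity staggering of an even
torus; a KS cochain exists only there when `d ≥ 2`, but the hypothesis is now just its existence.) -/
theorem IsTorusKSCochain.wilsonExpectation_wilsonLoopObs_neg [NeZero L]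
    {c : TorusSite d L → Fin d → ZMod 2} (hc : IsTorusKSCochain c) (hπ : IsDualParity (zdUnit d) π)
    (hρ : Continuous ρ) (hzc : ∀ g : G, z * g = g * z) (hz2 : z * z = 1) (hρz : ρ z = -1) (β : ℝ)
    {x : Site d} (C : (zdGraph d).Walk x x) :
    wilsonExpectation (L := L) ρ (-β)
        (toTorusObservable L (wilsonLoopObs (normalisedCharacter N ∘ ρ) C)) =
      (-1 : ℝ) ^ (areaParity π C).val *
        wilsonExpectation (L := L) ρ β
          (toTorusObservable L (wilsonLoopObs (normalisedCharacter N ∘ ρ) C)) := by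
  unfold wilsonExpectation
  rw [← gibbs_cubicUnit_eq_wilsonMeasure ρ hρ β, ← gibbs_cubicUnit_eq_wilsonMeasure ρ hρ (-β),
    ← (hc.isStaggering hzc hz2).integral_comp_centralTwist_gibbs ρ hρz β, ← integral_const_mul]
  refine integral_congr_ae (ae_of_all _ fun U => ?_)
  simp only [toTorusObservable_apply, wilsonLoopObs, Function.comp_apply, normalisedCharacter,
    hc.walkHolonomy_torusLift_centralTwist_closed hπ hzc hz2 U C, map_mul, rep_zpow₂ ρ hρz,
    smul_mul_assoc, one_mul, Matrix.trace_smul, Complex.smul_re, smul_eq_mul]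
  ring

end Contractible

/-! ## Loops with winding: closed cochains collect `z^{∑ v_m hol_m}` -/

section Winding

variable {z : G}

/-- The `ℤ^d` gradient of twist 11 (`ZdPoincare.latticeGrad`) is the cubical coboundary `LatticeForm.d₀`. -/
theorem latticeGrad_eq_d₀ {A : Type*} [AddCommGroup A] (Φ : Site d → A) :
    ZdPoincare.latticeGrad Φ = fun e => d₀ Φ e.1 e.2 := rfl

/-- ★★ **A CLOSED `{1,z}`-cochain of the torus collects `z^{∑_m v_m · hol_m}` along every `ℤ^d` walk
`x ⟶ x + L v`** (its pullback is the gradient of a primitive `Φ` with periods `∑ v_m hol_m`; an exact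
`ℤ^d` cochain collects `z^{Φ(x) + Φ(y)}`, twist 11). -/
theorem walkSign_pull_of_isClosed (hz2 : z * z = 1) {b : TorusSite d L → Fin d → ZMod 2}
    (hb : IsClosed b) {x y : Site d} (w : (zdGraph d).Walk x y) (v : Site d) (hy : y = x + (L : ℤ) • v) :
    walkSign (zpow₂ z ∘ pullCochain L b) w = zpow₂ z (∑ m, (v m : ZMod 2) * cycleHolonomy b m) := by
  obtain ⟨Φ, hΦ⟩ := exists_d₀_eq_of_d₁_eq_zero _ (d₁_pull_eq_zero hb)
  have hpull : (zpow₂ z ∘ pullCochain L b) = zpow₂ z ∘ ZdPoincare.latticeGrad Φ := by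
    funext e
    simp only [Function.comp_apply, latticeGrad_eq_d₀, hΦ]
    rfl
  rw [hpull, walkSign_zpow₂_latticeGrad hz2 Φ w, hy, TorusPoincare.apply_add_zsmul hΦ x v]
  congr 1
  have h2 : ∀ a : ZMod 2, a + a = 0 := by decide
  rw [← add_assoc, h2, zero_add]
  refine Finset.sum_congr rfl fun m _ => ?_
  rw [zsmul_eq_mul]

/-- ★★★ **Two KS staggerings give the loop with winding `v` weights differing by `z^{∑_m v_m hol_m(c₁+c₂)}`.** -/
theorem IsTorusKSCochain.walkSign_pull_eq (hzc : ∀ g : G, z * g = g * z) (hz2 : z * z = 1)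
    {c₁ c₂ : TorusSite d L → Fin d → ZMod 2} (h₁ : IsTorusKSCochain c₁) (h₂ : IsTorusKSCochain c₂)
    {x y : Site d} (w : (zdGraph d).Walk x y) (v : Site d) (hy : y = x + (L : ℤ) • v) :
    walkSign (zpow₂ z ∘ pullCochain L c₁) w =
      zpow₂ z (∑ m, (v m : ZMod 2) * cycleHolonomy (c₁ + c₂) m) * walkSign (zpow₂ z ∘ pullCochain L c₂) w := by
  conv_lhs => rw [eq_add_add_self c₁ c₂, zpow₂_comp_pullCochain_add hz2]
  rw [walkSign_mul (s₁ := zpow₂ z ∘ pullCochain L (c₁ + c₂)) (s₂ := zpow₂ z ∘ pullCochain L c₂)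
    (fun l g => zpow₂_comm hzc _ g), walkSign_pull_of_isClosed hz2 (h₁.add h₂) w v hy]

/-- ★★ **Staggerings of the same class give EVERY torus loop the same weight** (all relative holonomies
vanish), and so do ANY two staggerings on CONTRACTIBLE loops (`v = 0`, next lemma). -/
theorem IsTorusKSCochain.walkSign_pull_eq_of_cycleHolonomy_eq_zero (hzc : ∀ g : G, z * g = g * z)
    (hz2 : z * z = 1) {c₁ c₂ : TorusSite d L → Fin d → ZMod 2} (h₁ : IsTorusKSCochain c₁)
    (h₂ : IsTorusKSCochain c₂) (h0 : ∀ m, cycleHolonomy (c₁ + c₂) m = 0) {x y : Site d}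
    (w : (zdGraph d).Walk x y) (v : Site d) (hy : y = x + (L : ℤ) • v) :
    walkSign (zpow₂ z ∘ pullCochain L c₁) w = walkSign (zpow₂ z ∘ pullCochain L c₂) w := by
  rw [h₁.walkSign_pull_eq hzc hz2 h₂ w v hy]
  simp [h0, zpow₂]

/-- **Any two KS staggerings agree on contractible loops** (closed `ℤ^d` walks). -/
theorem IsTorusKSCochain.walkSign_pull_eq_of_closed (hzc : ∀ g : G, z * g = g * z) (hz2 : z * z = 1)
    {c₁ c₂ : TorusSite d L → Fin d → ZMod 2} (h₁ : IsTorusKSCochain c₁) (h₂ : IsTorusKSCochain c₂)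
    {x : Site d} (C : (zdGraph d).Walk x x) :
    walkSign (zpow₂ z ∘ pullCochain L c₁) C = walkSign (zpow₂ z ∘ pullCochain L c₂) C := by
  rw [h₁.walkSign_pull_eq hzc hz2 h₂ C 0 (by simp)]
  simp [zpow₂]

/-- The endpoint of the Polyakov line: `x + L e_m = x + L • e_m`. -/
theorem single_natCast_eq_zsmul (L : ℕ) (m : Fin d) :
    (Pi.single m (L : ℤ) : Site d) = (L : ℤ) • (Pi.single m 1 : Site d) := by
  rw [← Pi.single_smul', smul_eq_mul, mul_one]

/-- ★★★ **The Polyakov line in direction `m` detects exactly the `m`-th relative holonomy**: along the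
straight walk of `L` steps in direction `m` (once around the torus) two KS staggerings give weights
differing by `z^{hol_m(c₁ + c₂)}`. -/
theorem IsTorusKSCochain.walkSign_pull_lineWalk (hzc : ∀ g : G, z * g = g * z) (hz2 : z * z = 1)
    {c₁ c₂ : TorusSite d L → Fin d → ZMod 2} (h₁ : IsTorusKSCochain c₁) (h₂ : IsTorusKSCochain c₂)
    (m : Fin d) (x : Site d) :
    walkSign (zpow₂ z ∘ pullCochain L c₁) (lineWalk m L x) =
      zpow₂ z (cycleHolonomy (c₁ + c₂) m) * walkSign (zpow₂ z ∘ pullCochain L c₂) (lineWalk m L x) := by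
  rw [h₁.walkSign_pull_eq hzc hz2 h₂ (lineWalk m L x) (Pi.single m 1) (by rw [single_natCast_eq_zsmul])]
  congr 2
  rw [Finset.sum_eq_single m]
  · simp
  · intro m' _ hm'; simp [Pi.single_eq_of_ne hm']
  · intro h; exact absurd (Finset.mem_univ m) h

/-- **The parity staggering of the even torus gives every Polyakov line the weight `1`** (twist 12's
`twistParity_lineWalk_of_even`, read through the pullback). -/
theorem walkSign_pull_stagParity_lineWalk {π : Fin d → Site d →+ ZMod 2} (hπ : IsDualParity (zdUnit d) π)
    (h2 : 2 ∣ L) (hz2 : z * z = 1) (r m : Fin d) (x : Site d) :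
    walkSign (zpow₂ z ∘ pullCochain L (fun y i => stagParity (cubicParity d L h2) r (y, i)))
      (lineWalk m L x) = 1 := by
  have hpull : (zpow₂ z ∘ pullCochain L (fun y i => stagParity (cubicParity d L h2) r (y, i))) =
      stagTwist π r z := by
    funext e
    obtain ⟨y, i⟩ := e
    simp only [Function.comp_apply, pullCochain_apply, stagTwist, stagParity_torusProj hπ h2 r y i]
  rw [hpull, walkSign_stagTwist hπ hz2 r, twistParity_lineWalk_of_even hπ r m (even_iff_two_dvd.2 h2)]
  simp [zpow₂]

/-- ★★ **In the sector `ε` the Polyakov line in direction `m` collects `z^{ε_m}`**: the sector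
staggering `stagParity + ∑_m sheet m (ε m)` of the even torus multiplies the holonomy once around the
torus in direction `m` by `z^{ε m}` (and, like every KS staggering, every contractible loop by
`z^{a(C)}`). -/
theorem walkSign_pull_sector_lineWalk [NeZero L] {π : Fin d → Site d →+ ZMod 2}
    (hπ : IsDualParity (zdUnit d) π) (h2 : 2 ∣ L) (hzc : ∀ g : G, z * g = g * z) (hz2 : z * z = 1)
    (r : Fin d) (ε : Fin d → ZMod 2) (m : Fin d) (x : Site d) :
    walkSign (zpow₂ z ∘ pullCochain L ((fun y i => stagParity (cubicParity d L h2) r (y, i)) +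
      ∑ m, sheet m (ε m))) (lineWalk m L x) = zpow₂ z (ε m) := by
  rw [(isTorusKSCochain_sector h2 r ε).walkSign_pull_lineWalk hzc hz2 (isTorusKSCochain_stagParity h2 r)
    m x, walkSign_pull_stagParity_lineWalk hπ h2 hz2 r m x, mul_one]
  congr 1
  set p : TorusSite d L → Fin d → ZMod 2 := fun y i => stagParity (cubicParity d L h2) r (y, i)
  rw [add_comm p, add_assoc, cycleHolonomy_add, cycleHolonomy_sum]
  have hpp : cycleHolonomy (p + p) m = 0 := by
    rw [cycleHolonomy_add, cycleHolonomy_stagParity, add_zero]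
  simp only [cycleHolonomy_sheet, Finset.sum_ite_eq, Finset.mem_univ, if_true, hpp, add_zero]

end Winding

end TiltedRP

end Summit.QuantumFields.GaugeBoot
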